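import Summits.QuantumFields.YangMills.Theses.ParabolicTrajectory
import Literature.MathematicalPhysics.QuantumLattice.BoundedWilsonFlowLift
import Summits.QuantumFields.YangMills.Theorems.ParabolicTrajectoryContinuumLimitOnTrajectoryStubOSLegsD_Assembly
import Summits.QuantumFields.YangMills.Theorems.ContinuumLimitOnTrajectory.Negative.UltralocalNoLimit
import HarnessLib.Audit

/-!
# Line `curtiss-flowed-free-energies` — crux `ContinuumLimitOnTrajectory` (stmt-QuantumFields-10522), skeleton v2

Lead `prover-line-stmt-QuantumFields-10522-1` (second seating, 2026-08-16). RESHAPE of the planner's skeleton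
(`Lines/curtiss_flowed_free_energies.lean`, 7 stubs) onto the LANDED vocabulary of line `two-orbit-synchronisation`
(`Theorems/ParabolicTrajectoryContinuumLimitOnTrajectoryDefs{,B}.lean`: `canon`, `curvNPoint`, `curvDistribution`,
`ConvProducts`, `UVB`, `AsympEuclid`, `ARP`, `UCL`, `ND2`, `ND3`, `UVRegularity`, `ClusteringLeg`) so that

* the OS packaging is no longer a stub: it is the landed theorem `oneFieldOSLegs'`
  (`…StubOSLegsD_Assembly`, `ConvProducts → UVB → AsympEuclid → ARP → UCL → ND2 → ND3 → ∃ T, IsYangMillsFor r (canon r sch) T ∧ …`);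
* the shared ultraviolet / infrared legs are LITERALLY two-orbit's registered open stubs `UVRegularity`
  (`UVB ∧ AsympEuclid ∧ ARP ∧ ND2 ∧ ND3`, incl. this card's ROT/ND/NG) and `ClusteringLeg` (`UCL`; the time-exponential half
  of the planner's `CL` is dropped — E0–E4 do not need it);
* what is specific to THIS line is isolated in five stubs: the ENGINE `stub_flowedFreeEnergyLimit` (unchanged statement),
  the torus Wilson-flow continuity `stub_flowContinuity` (tree debt, "Deliberately NOT here" of `BoundedWilsonFlowLift`),
  the abstract multivariate CURTISS theorem `stub_curtiss`, the measure-theoretic glue `stub_momentsOfFreeEnergies`, and the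
  small-flow-time transfer `stub_smallFlowTimeTransfer` (`SFTApprox`, now stated on `curvNPoint`).

Composition `ContinuumLimitOnTrajectory_of` (kernel-checked, no `sorry`): ENGINE ⇒ `FFEConv`; flow continuity ⇒
`FlowXContinuous`; CURTISS + glue ⇒ `FlowMomentsConv`; SFT + the 3ε lemma (proved here) ⇒ `ConvProducts`; `UVRegularity`,
`ClusteringLeg` ⇒ the OS inputs; `oneFieldOSLegs'` ⇒ `T`; witness scheme `canon r sch` (same `a, β, L` by `rfl`).

Disproof used (`Cruxes/ContinuumLimitOnTrajectory/Disproof.lean`, cdisprove gen 3, RESISTS; no `-- Targets` on line stubs at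
v2 time): the load-bearing pair {`β_k → ∞`, `θ > 0`} (`Negative.continuumLimitOnTrajectory_false_without_AF`) enters at the
engine (whole `CruxHyp` + the `θ`-window) and at `ND2` inside `UVRegularity`; on the `β ≡ 0` ultralocal scheme `FFEConv`,
`FlowMomentsConv`, `SFTApprox` may all hold but `ND2` fails (`Negative.not_isNontrivial_beta_zero`), so nothing here proves the
refuted `…WithoutAF`. §4 witness rigidity is consistent with `c_k = a_k⁻⁴` (`canon`); §5/§7/§8 necessary conditions II–IV are
implied by `ConvProducts`/`AsympEuclid`, IV′ is `¬ ND3`.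
-/

open scoped SchwartzMap
open MeasureTheory Filter Topology
open Literature.MathematicalPhysics.AQFT Literature.MathematicalPhysics.QuantumLattice
open Literature.Probability.LatticeModels
open Literature.MathematicalPhysics.QuantumFieldTheory
open Summit.QuantumFields.YangMills.Theses.ParabolicTrajectory
open Summit.QuantumFields.YangMills.Cruxes.ContinuumLimitOnTrajectory.TwoOrbitSynchronisation

noncomputable section

namespace Summit.QuantumFields.YangMills.Cruxes.ContinuumLimitOnTrajectory.CurtissFlowedFreeEnergies

local notation "𝔼" => EuclideanSpace ℝ (Fin 4)

/-! ### Objects of the line (flowed observables) -/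

section Objects

variable {G : Type} [Group G] [TopologicalSpace G] [IsTopologicalGroup G] [CompactSpace G]
  [MeasurableSpace G] [BorelSpace G]

/-- The torus Wilson measure of the scheme at step `k` (side `2 L_k + 1`, coupling `β_k`). [folklore] -/
abbrev μW (r : LatticeRep G) (sch : SpeciesScheme (YMSpecies G)) (k : ℕ) :
    Measure (GaugeConfig 4 (sch.side k) G) :=
  wilsonMeasure (d := 4) (L := sch.side k) r.ρ (sch.β k)

/-- **The smeared flowed action density at physical flow time `τ`**:
`X_k(τ, f)(U) = ∑_{x ∈ box} f(a_k x) · E_{τ/a_k²}(x)(Ũ)` with `E_t(x)` Lüscher's flowed plaquette density (3.1) along the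
(bounded = torus) Wilson flow through `r.ρ` (tree `boundedFlowedEnergy`, lift lemma `boundedFlowedEnergy_torusLift`).
No explicit `a⁴`: the Riemann weight `a⁴` cancels the canonical weight `a⁻⁴` of the dimension-4 density. [cite: Luscher2010, eqs. (1.4), (3.1)] -/
def flowX (r : LatticeRep G) (sch : SpeciesScheme (YMSpecies G)) (τ : ℝ) (f : 𝓢(𝔼, ℝ)) (k : ℕ)
    (U : GaugeConfig 4 (sch.side k) G) : ℝ :=
  ∑ x ∈ box 4 (sch.L k), f (sch.a k • siteToE x) *
    boundedFlowedEnergy r.ρ (τ / sch.a k ^ 2) x (torusLift (sch.side k) U)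

/-- **The flowed free energy with real sources** `F_k(s⃗) = log ∫ exp(∑ᵢ sᵢ X_k(τ, fᵢ)) dμ_k`. [folklore] -/
def flowF (r : LatticeRep G) (sch : SpeciesScheme (YMSpecies G)) (τ : ℝ) (m : ℕ)
    (f : Fin m → 𝓢(𝔼, ℝ)) (s : Fin m → ℝ) (k : ℕ) : ℝ :=
  Real.log (∫ U, Real.exp (∑ i, s i * flowX r sch τ (f i) k U) ∂(μW r sch k))

/-- **The centred mixed flowed moment** `∫ ∏ᵢ (X_k(τ,fᵢ) − ⟨X_k(τ,fᵢ)⟩_k) dμ_k`. [folklore] -/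
def flowCMoment (r : LatticeRep G) (sch : SpeciesScheme (YMSpecies G)) (τ : ℝ) (m : ℕ)
    (f : Fin m → 𝓢(𝔼, ℝ)) (k : ℕ) : ℝ :=
  ∫ U, ∏ i, (flowX r sch τ (f i) k U - ∫ V, flowX r sch τ (f i) k V ∂(μW r sch k)) ∂(μW r sch k)

/-- **Hypothesis block of the crux** for `(r, M, θ, Δ, sch, n)` (= `Disproof.Hyp`). [folklore] -/
def CruxHyp (r : LatticeRep G) (M : ℕ) (θ Δ : ℝ) (sch : SpeciesScheme (YMSpecies G)) (n : ℕ → ℕ) :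
    Prop :=
  (∀ k, sch.a k = ((M : ℝ) ^ n k)⁻¹) ∧ Tendsto sch.β atTop atTop ∧
    (∀ t : ℕ, 0 < t → ∃ c : ℝ, Tendsto (fun k => ((M : ℝ) ^ n k) ^ 8 *
      latticeConnectedCorr r.ρ (sch.β k) (sch.side k) r.curvature.F r.curvature.F (t * M ^ n k))
        atTop (𝓝 c)) ∧
    Tendsto (fun k => ((M : ℝ) ^ n k) ^ 8 *
      latticeConnectedCorr r.ρ (sch.β k) (sch.side k) r.curvature.F r.curvature.F (M ^ n k))
        atTop (𝓝 θ) ∧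
    HasLatticeMassGap r sch Δ

/-- (ENGINE output) **flowed free energies converge** with small real sources, along the FULL sequence. [folklore] -/
def FFEConv (r : LatticeRep G) (sch : SpeciesScheme (YMSpecies G)) : Prop :=
  ∀ (m : ℕ) (f : Fin m → 𝓢(𝔼, ℝ)) (τ : ℝ), 0 < τ → ∃ δ : ℝ, 0 < δ ∧
    ∀ s : Fin m → ℝ, (∀ i, |s i| < δ) → ∃ c : ℝ, Tendsto (fun k => flowF r sch τ m f s k) atTop (𝓝 c)

/-- (CURTISS output) **all centred mixed flowed moments converge**, every family, every `τ > 0`. [folklore] -/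
def FlowMomentsConv (r : LatticeRep G) (sch : SpeciesScheme (YMSpecies G)) : Prop :=
  ∀ (m : ℕ) (f : Fin m → 𝓢(𝔼, ℝ)) (τ : ℝ), 0 < τ →
    ∃ c : ℝ, Tendsto (fun k => flowCMoment r sch τ m f k) atTop (𝓝 c)

/-- **The flowed observables are continuous** in the torus configuration (consequence of the flow-continuity stub). [folklore] -/
def FlowXContinuous (r : LatticeRep G) (sch : SpeciesScheme (YMSpecies G)) : Prop :=
  ∀ τ : ℝ, 0 < τ → ∀ (f : 𝓢(𝔼, ℝ)) (k : ℕ), Continuous (flowX r sch τ f k)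

/-- (SMALL FLOW TIME) **uniform small-flow-time approximation at separated points**, on the two-orbit vocabulary:
one matching function `c_E(τ)` such that for every off-diagonal real product tensor the CANONICAL unflowed `p`-point
function `curvNPoint` (`c = a⁻⁴`, exact centring) is within `ε` of `c_E(τ)ᵖ ×` the centred flowed moment, for `τ`
small and all large `k` (uniformity in `k` is the content). [cite: arXiv:1306.1173] -/
def SFTApprox (r : LatticeRep G) (sch : SpeciesScheme (YMSpecies G)) : Prop :=
  ∃ cE : ℝ → ℝ, ∀ (p : ℕ), p ≠ 0 → ∀ (f : Fin p → 𝓢(𝔼, ℝ)),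
    IsOffDiagonal (SchwartzMap.tensorFin p fun i => ofRealTest (f i)) →
      ∀ ε : ℝ, 0 < ε → ∃ τ : ℝ, 0 < τ ∧ ∀ᶠ k in atTop,
        |curvNPoint r sch k p f - cE τ ^ p * flowCMoment r sch τ p f k| ≤ ε

/-- **Conclusion of the crux** for `(r, sch)` (= `Disproof.Concl`). [folklore] -/
def CruxConcl (r : LatticeRep G) (sch : SpeciesScheme (YMSpecies G)) : Prop :=
  ∃ sch' : SpeciesScheme (YMSpecies G), sch'.a = sch.a ∧ sch'.β = sch.β ∧ sch'.L = sch.L ∧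
    ∃ T : OSData (YMSpecies G) 4,
      IsYangMillsFor r sch' T ∧ T.IsNontrivial r.curvature ∧ T.IsNonGaussian r.curvature

end Objects

/-! ### Two gauge-free statements (tree debt / probability): continuity of the torus Wilson flow, Curtiss -/

/-- **Continuity of the torus Wilson-flowed action density in the configuration**, for EVERY compact `G` and every
faithful unitary lattice representation `r` (global existence of Lüscher's flow line on the finite torus for unitary data —
Picard–Lindelöf for the cut-off field + invariance of the unitary sphere since `π_𝔤` of `range ρ ⊆ U(N)` is anti-Hermitian —
uniqueness `IsWilsonFlowLine.unique_of_finite`, Gronwall continuity in the data; then `boundedFlowedEnergy_torusLift`).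
The tree has this for `SU(n)` only (`QuantumFieldTheory/WilsonFlow.lean`). [cite: Luscher2010, §1 p. 2 and App. C] -/
def BoundedFlowedEnergyContinuous : Prop :=
  ∀ (G : Type) [Group G] [TopologicalSpace G] [IsTopologicalGroup G] [CompactSpace G]
    (r : LatticeRep G) (S : ℕ) [NeZero S] (t : ℝ), 0 ≤ t → ∀ x : Fin 4 → ℤ,
      Continuous fun U : GaugeConfig 4 S G => boundedFlowedEnergy r.ρ t x (torusLift S U)

/-- **Curtiss' theorem, multivariate** (Curtiss 1942, Thm 3): probability laws `ν_k` on `ℝᵐ` whose moment generating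
functions are finite and converge pointwise (to finite limits) on an open cube around `0` have convergent mixed moments
of every order. (Pointwise-convergent convex MGFs are bounded on the cube uniformly in `k`; exponential moment bounds give
`|m_α(k)| ≤ C α! δ^{-|α|}`; the MGFs are the multivariate power series of the moments on the cube; coefficientwise limits
exist by compactness and are unique by the identity theorem.) [cite: doi:10.1214/aoms/1177731541, Thm 3] -/
def CurtissTheorem : Prop :=
  ∀ (m : ℕ) (ν : ℕ → Measure (Fin m → ℝ)), (∀ k, IsProbabilityMeasure (ν k)) →
    ∀ δ : ℝ, 0 < δ →
      (∀ s : Fin m → ℝ, (∀ i, |s i| < δ) →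
        (∀ k, Integrable (fun x => Real.exp (∑ i, s i * x i)) (ν k)) ∧
          ∃ L : ℝ, Tendsto (fun k => ∫ x, Real.exp (∑ i, s i * x i) ∂(ν k)) atTop (𝓝 L)) →
      ∀ p : Fin m → ℕ, ∃ c : ℝ, Tendsto (fun k => ∫ x, ∏ i, x i ^ p i ∂(ν k)) atTop (𝓝 c)

/-! ### Stub statements (closed `Prop`s) -/

namespace Statement

/-- **Stub 1 — ENGINE (borrowed; carries the universality content; hardest).** Along every scheme in the crux's
hypothesis block (block factor `M ≥ M₀(G,r)`, tuning window `θ < θ₀`), the flowed free energies with small REAL sources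
converge along the full sequence. A source `s ∫ J E_τ` is a bounded smooth quasi-local perturbation of Wilson's action at
scale `√τ`, so this is the scalar (partition-function) form of (A); its natural proof is the promoted two-orbit chart
`ChartExists` applied to scalar observables. Honours `not_withoutAF`: uses AF and `θ > 0` through `CruxHyp`/the window. -/
def stub_flowedFreeEnergyLimit : Prop :=
  ∀ (G : Type) [Group G] [TopologicalSpace G] [IsTopologicalGroup G] [CompactSpace G],
    IsCompactSimpleLieGroup G →
      letI : MeasurableSpace G := borel G
      haveI : BorelSpace G := ⟨rfl⟩
      ∀ r : LatticeRep G, ∃ M₀ : ℕ, ∀ M : ℕ, M₀ ≤ M → 2 ≤ M → ∃ θ₀ : ℝ, 0 < θ₀ ∧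
        ∀ (θ Δ : ℝ) (sch : SpeciesScheme (YMSpecies G)) (n : ℕ → ℕ),
          0 < θ → θ < θ₀ → 0 < Δ → CruxHyp r M θ Δ sch n → FFEConv r sch

/-- **Stub 2 — FLOW CONTINUITY (true, M/L; tree debt).** `BoundedFlowedEnergyContinuous`. -/
def stub_flowContinuity : Prop := BoundedFlowedEnergyContinuous

/-- **Stub 3 — CURTISS, abstract (true, L; Literature/Probability grade).** `CurtissTheorem`. -/
def stub_curtiss : Prop := CurtissTheorem

/-- **Stub 4 — MOMENTS OF THE FLOWED FREE ENERGIES (glue, true, M).** Given Curtiss' theorem (by name) and the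
continuity of the flowed observables: convergence of the flowed free energies on a real neighbourhood of `0` ⇒ convergence
of every centred mixed flowed moment (push the torus Wilson measure forward under `U ↦ (X_k(τ,fᵢ)(U))ᵢ`, bounded continuous
hence with all exponential moments; `exp ∘ flowF` converges; expand the centred product). -/
def stub_momentsOfFreeEnergies : Prop :=
  CurtissTheorem →
    ∀ (G : Type) [Group G] [TopologicalSpace G] [IsTopologicalGroup G] [CompactSpace G]
      [MeasurableSpace G] [BorelSpace G] (r : LatticeRep G) (sch : SpeciesScheme (YMSpecies G)),
      FlowXContinuous r sch → FFEConv r sch → FlowMomentsConv r sch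

/-- **Stub 5 — SMALL-FLOW-TIME TRANSFER (L/open; this line's one new UV statement).** Along every scheme of the
hypothesis block: `SFTApprox` — a `k`-UNIFORM small-flow-time expansion of the curvature species at separated points,
`E_τ = c_E(τ)·[a⁻⁴(P − ⟨P⟩)] + O(τ)` inside correlators with off-diagonal real product tensors (Lüscher–Weisz: flowed
composites need no renormalisation; the bare `tr F²` density has a finite multiplicative renormalisation `1 + O(g₀²) → 1` at the
asymptotically free point, so `c = a⁻⁴` is the right weight; Suzuki / Del Debbio–Patella–Rago small-flow-time expansion). [cite: arXiv:1306.1173] [cite: arXiv:1101.0963] -/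
def stub_smallFlowTimeTransfer : Prop :=
  ∀ (G : Type) [Group G] [TopologicalSpace G] [IsTopologicalGroup G] [CompactSpace G],
    IsCompactSimpleLieGroup G →
      letI : MeasurableSpace G := borel G
      haveI : BorelSpace G := ⟨rfl⟩
      ∀ (r : LatticeRep G) (M : ℕ) (θ Δ : ℝ) (sch : SpeciesScheme (YMSpecies G)) (n : ℕ → ℕ),
        2 ≤ M → 0 < θ → 0 < Δ → CruxHyp r M θ Δ sch n → SFTApprox r sch

/-- **Stub 6 — UV REGULARITY (open; SHARED with line two-orbit).** By definition two-orbit's registered statement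
`TwoOrbitSynchronisation.UVRegularity` (`…DefsB`): along a crux-admissible sequence with `ConvProducts`,
`UVB ∧ AsympEuclid ∧ ARP ∧ ND2 ∧ ND3`. Any proof of either closes both (`Iff.rfl`). -/
def stub_uvRegularity : Prop := UVRegularity

/-- **Stub 7 — CLUSTERING LEG (open IR input; SHARED with line two-orbit).** By definition two-orbit's registered
statement `TwoOrbitSynchronisation.ClusteringLeg` (`…DefsB`): `… → ConvProducts → UVB → UCL`. -/
def stub_clustering : Prop := ClusteringLeg

end Statement

/-! ### Registered stubs (the only `sorry`s of this file) -/

/-- Stub 1 (ENGINE, hardest; lead). -/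
theorem stub_flowedFreeEnergyLimit : Statement.stub_flowedFreeEnergyLimit := by
  sorry

/-- Stub 2 (torus Wilson-flow continuity; true). -/
theorem stub_flowContinuity : Statement.stub_flowContinuity := by
  sorry

/-- Stub 3 (Curtiss' theorem, abstract; true). -/
theorem stub_curtiss : Statement.stub_curtiss := by
  sorry

/-- Stub 4 (glue: moments of the flowed free energies; true). -/
theorem stub_momentsOfFreeEnergies : Statement.stub_momentsOfFreeEnergies := by
  sorry

/-- Stub 5 (small-flow-time transfer; open UV input). -/
theorem stub_smallFlowTimeTransfer : Statement.stub_smallFlowTimeTransfer := by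
  sorry

/-- Stub 6 (= two-orbit's registered `stub_uvRegularity`, verbatim statement `UVRegularity`; open UV legs
`UVB ∧ AsympEuclid ∧ ARP ∧ ND2 ∧ ND3`). -/
theorem stub_uvRegularity : Statement.stub_uvRegularity := by
  sorry

/-- Stub 7 (= two-orbit's registered `stub_clustering`, verbatim statement `ClusteringLeg`; open IR leg `UCL`). -/
theorem stub_clustering : Statement.stub_clustering := by
  sorry

/-! ### Proved glue and the composition (no `sorry` below this line) -/

/-- **3ε lemma.** A real sequence that is, for every `ε > 0`, eventually `ε`-close to SOME convergent sequence is
Cauchy, hence convergent. [folklore] -/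
theorem tendsto_of_eventually_approx {u : ℕ → ℝ}
    (h : ∀ ε : ℝ, 0 < ε → ∃ v : ℕ → ℝ, (∃ c, Tendsto v atTop (𝓝 c)) ∧ ∀ᶠ k in atTop, |u k - v k| ≤ ε) :
    ∃ c, Tendsto u atTop (𝓝 c) := by
  have hc : CauchySeq u := by
    refine Metric.cauchySeq_iff.2 fun ε hε => ?_
    obtain ⟨v, ⟨c, hv⟩, huv⟩ := h (ε / 4) (by positivity)
    obtain ⟨N₁, hN₁⟩ := Metric.cauchySeq_iff.1 hv.cauchySeq (ε / 4) (by positivity)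
    obtain ⟨N₂, hN₂⟩ := eventually_atTop.1 huv
    refine ⟨max N₁ N₂, fun m hm n hn => ?_⟩
    have h1 := hN₂ m (le_of_max_le_right hm)
    have h2 := hN₂ n (le_of_max_le_right hn)
    have h3 := hN₁ m (le_of_max_le_left hm) n (le_of_max_le_left hn)
    rw [Real.dist_eq] at h3 ⊢
    have h2' : |v n - u n| ≤ ε / 4 := by rw [abs_sub_comm]; exact h2
    calc |u m - u n| = |(u m - v m) + (v m - v n) + (v n - u n)| := by ring_nf
      _ ≤ |u m - v m| + |v m - v n| + |v n - u n| := abs_add_three _ _ _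
      _ < ε := by linarith
  exact cauchySeq_tendsto_of_complete hc

section Compose

variable {G : Type} [Group G] [TopologicalSpace G] [IsTopologicalGroup G] [CompactSpace G]
  [MeasurableSpace G] [BorelSpace G]

omit [BorelSpace G] in
/-- The flowed observables are finite sums of constants times the flowed density, hence continuous once the latter is. [folklore] -/
theorem flowXContinuous_of (hF : BoundedFlowedEnergyContinuous) (r : LatticeRep G)
    (sch : SpeciesScheme (YMSpecies G)) : FlowXContinuous r sch := by
  intro τ hτ f k
  unfold flowX
  refine continuous_finsetSum _ fun x _ => continuous_const.mul ?_
  exact hF G r (sch.side k) (τ / sch.a k ^ 2) (div_nonneg hτ.le (sq_nonneg _)) x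

/-- **Flowed moments converge at every flow time + uniform small-flow-time approximation ⇒ the canonical unflowed
curvature functions converge on off-diagonal products along the full sequence** (3ε). [folklore] -/
theorem convProducts_of_sft (r : LatticeRep G) (sch : SpeciesScheme (YMSpecies G))
    (hMom : FlowMomentsConv r sch) (hSFT : SFTApprox r sch) : ConvProducts r sch := by
  obtain ⟨cE, hS⟩ := hSFT
  intro p hp f hoff
  refine tendsto_of_eventually_approx fun ε hε => ?_
  obtain ⟨τ, hτ, hev⟩ := hS p hp f hoff ε hε
  obtain ⟨c, hc⟩ := hMom p f τ hτ
  exact ⟨fun k => cE τ ^ p * flowCMoment r sch τ p f k, ⟨cE τ ^ p * c, hc.const_mul _⟩, hev⟩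

end Compose

/-- **Composition (kernel-checked).** The seven stub statements imply crux (A)
`ParabolicTrajectory.ContinuumLimitOnTrajectory` BY NAME: fix `G, r`; `M₀, θ₀` from the engine; for a scheme in the
hypothesis block, ENGINE ⇒ flowed free energies converge; FLOW CONTINUITY + CURTISS + glue ⇒ flowed moments converge;
SMALL FLOW TIME + 3ε ⇒ `ConvProducts`; `UVRegularity` ⇒ `UVB ∧ AsympEuclid ∧ ARP ∧ ND2 ∧ ND3`; `ClusteringLeg` ⇒ `UCL`; the
landed `oneFieldOSLegs'` gives `T`; the witness scheme is `canon r sch` (same `a, β, L`). -/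
theorem ContinuumLimitOnTrajectory_of :
    Statement.stub_flowedFreeEnergyLimit → Statement.stub_flowContinuity → Statement.stub_curtiss →
      Statement.stub_momentsOfFreeEnergies → Statement.stub_smallFlowTimeTransfer →
        Statement.stub_uvRegularity → Statement.stub_clustering → ContinuumLimitOnTrajectory := by
  intro hE hF' hC' hM hS hU' hL' G _ _ _ _ hG
  have hF : BoundedFlowedEnergyContinuous := hF'
  have hC : CurtissTheorem := hC'
  have hU : UVRegularity := hU'
  have hL : ClusteringLeg := hL'
  letI : MeasurableSpace G := borel G
  haveI : BorelSpace G := ⟨rfl⟩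
  intro r
  obtain ⟨M₀, hM₀⟩ := hE G hG r
  refine ⟨M₀, fun M hMM h2 => ?_⟩
  obtain ⟨θ₀, hθ₀, hθ⟩ := hM₀ M hMM h2
  refine ⟨θ₀, hθ₀, fun θ Δ sch n h0 h1 hΔ ha hβ hconv htune hgap => ?_⟩
  have hH : CruxHyp r M θ Δ sch n := ⟨ha, hβ, hconv, htune, hgap⟩
  have hFFE : FFEConv r sch := hθ θ Δ sch n h0 h1 hΔ hH
  have hcont : FlowXContinuous r sch := flowXContinuous_of hF r sch
  have hMom : FlowMomentsConv r sch := hM hC G r sch hcont hFFE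
  have hSFT : SFTApprox r sch := hS G hG r M θ Δ sch n h2 h0 hΔ hH
  have hConv : ConvProducts r sch := convProducts_of_sft r sch hMom hSFT
  obtain ⟨hUVB, hAE, hARP, hND2, hND3⟩ :=
    hU G hG r M θ Δ sch n h0 hΔ ha hβ hconv htune hgap hConv
  have hUCL : UCL r sch := hL G hG r M θ Δ sch n h0 hΔ ha hβ hconv htune hgap hConv hUVB
  obtain ⟨T, hYM, hNT, hNG⟩ := oneFieldOSLegs' G r sch hConv hUVB hAE hARP hUCL hND2 hND3
  exact ⟨canon r sch, rfl, rfl, rfl, T, hYM, hNT, hNG⟩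

/-- The same composition with the registered stubs plugged in (its only `sorry`s are theirs). -/
theorem continuumLimitOnTrajectory_skeleton : ContinuumLimitOnTrajectory :=
  ContinuumLimitOnTrajectory_of stub_flowedFreeEnergyLimit stub_flowContinuity stub_curtiss
    stub_momentsOfFreeEnergies stub_smallFlowTimeTransfer stub_uvRegularity stub_clustering

/-! ### Read-back checks (no `sorry`) -/

section ReadBack

variable {G : Type} [Group G] [TopologicalSpace G] [IsTopologicalGroup G] [CompactSpace G]
  [MeasurableSpace G] [BorelSpace G]

/-- `CruxConcl` for the canonical witness: what the packaging delivers is literally the conclusion of the crux. [folklore] -/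
theorem cruxConcl_of_canon (r : LatticeRep G) (sch : SpeciesScheme (YMSpecies G))
    (h : ∃ T : OSData (YMSpecies G) 4,
      IsYangMillsFor r (canon r sch) T ∧ T.IsNontrivial r.curvature ∧ T.IsNonGaussian r.curvature) :
    CruxConcl r sch := by
  obtain ⟨T, hT⟩ := h
  exact ⟨canon r sch, rfl, rfl, rfl, T, hT⟩

/-- The torus Wilson measure of the scheme is a probability measure (continuity of `r.ρ`). [folklore] -/
instance isProbabilityMeasure_μW (r : LatticeRep G) (sch : SpeciesScheme (YMSpecies G)) (k : ℕ) :
    IsProbabilityMeasure (μW r sch k) :=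
  isProbabilityMeasure_wilsonMeasure (d := 4) (L := sch.side k) r.ρ r.continuous (sch.β k)

/-- The crux read back through `CruxHyp`/`CruxConcl` (= Disproof `crux_iff`). [folklore] -/
theorem crux_iff_hyp_concl :
    ContinuumLimitOnTrajectory ↔
      ∀ (G : Type) [Group G] [TopologicalSpace G] [IsTopologicalGroup G] [CompactSpace G],
        IsCompactSimpleLieGroup G →
          letI : MeasurableSpace G := borel G
          haveI : BorelSpace G := ⟨rfl⟩
          ∀ r : LatticeRep G, ∃ M₀ : ℕ, ∀ M : ℕ, M₀ ≤ M → 2 ≤ M → ∃ θ₀ : ℝ, 0 < θ₀ ∧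
            ∀ (θ Δ : ℝ) (sch : SpeciesScheme (YMSpecies G)) (n : ℕ → ℕ),
              0 < θ → θ < θ₀ → 0 < Δ → CruxHyp r M θ Δ sch n → CruxConcl r sch := by
  unfold ContinuumLimitOnTrajectory CruxHyp CruxConcl
  refine forall_congr' fun G => forall_congr' fun _ => forall_congr' fun _ =>
    forall_congr' fun _ => forall_congr' fun _ => forall_congr' fun _ => forall_congr' fun r =>
    exists_congr fun M₀ => forall_congr' fun M => forall_congr' fun _ => forall_congr' fun _ =>
    exists_congr fun θ₀ => and_congr Iff.rfl <| forall_congr' fun θ => forall_congr' fun Δ =>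
    forall_congr' fun sch => forall_congr' fun n => forall_congr' fun _ => forall_congr' fun _ =>
    forall_congr' fun _ => ⟨fun h H => h H.1 H.2.1 H.2.2.1 H.2.2.2.1 H.2.2.2.2,
      fun h h1 h2 h3 h4 h5 => h ⟨h1, h2, h3, h4, h5⟩⟩

/-- The shared legs ARE two-orbit's registered statements (literal sharing, by `Iff.rfl`). -/
example : (Statement.stub_uvRegularity ↔ UVRegularity) ∧ (Statement.stub_clustering ↔ ClusteringLeg) :=
  ⟨Iff.rfl, Iff.rfl⟩

/-- The load-bearing pair {`β_k → ∞`, `θ > 0`} (`Negative.continuumLimitOnTrajectory_false_without_AF`) is a theorem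
about the crux; in this line `β_k → ∞` and the window `θ < θ₀` are consumed by the engine, `θ > 0` by `ND2`. -/
example := @Summit.QuantumFields.YangMills.Theorems.ContinuumLimitOnTrajectory.Negative.continuumLimitOnTrajectory_false_without_AF

end ReadBack

end Summit.QuantumFields.YangMills.Cruxes.ContinuumLimitOnTrajectory.CurtissFlowedFreeEnergies

end
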